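import Mathlib.Analysis.SpecialFunctions.Log.Deriv
import Mathlib.Tactic.Module
import Literature.Analysis.FluidPDE.CarlemanFirst
import HarnessLib

/-!
# The first Carleman inequality of Escauriaza–Seregin–Šverák, proved (Seregin 2014, Prop. 1.2)

Analysis/FluidPDE file completing the backward-uniqueness track's first Carleman inequality
(decomposition of **ns.S08** `Literature.Analysis.FluidPDE.ess_endpoint`: ESS 2003 Thm. 1.3 ⇐
Thm. 1.4 ⇐ Thms. 4.1/5.1 ⇐ the Carleman inequalities of §6 = Seregin 2014, App. A.1). The `L₂`
core — the commutator identity and the estimates (A.1.7)–(A.1.10) for `v` and the operator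
`P = S + A` — is `FluidPDE/CarlemanFirst`; here we carry out the conjugation `v = e^φ u`,
`φ(x, t) = -|x|²/(8t) - (a+1) log h(t)`, `h(t) = t e^{(1-t)/3}`:

* `fderiv_phiW_apply` — `∇φ = -x/(4t)`, `∂ₜφ = |x|²/(8t²) - (a+1)(1/t - 1/3)`;
* `dx_conj`, `dt_conj`, `xdx_conj`, `dx_dx_conj`, `lap_conj` — first and second derivatives of
  `e^φ u` (`Δ(e^φ u) = e^φ (Δu - (x·∇)u/2t + (|x|²/16t² - n/4t) u)`);
* `opP_conj` — **`P(e^φ u) = t e^φ (∂ₜu + Δu)`** (Seregin 2014, (A.1.2): `tL = S + A`), all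
  lower-order terms cancelling;
* `exp_mul_gradSq_le` — (A.1.11): `e^{2φ}|∇u|² ≤ 2|∇v|² + |x|²|v|²/(8t²)`;
* `carleman_inequality_first` — **Prop. 1.2, (A.1.1)**: for `u` smooth, compactly supported in
  `]0, 2[ × E`, and `a > 0`,
  `∫ h^{-2a} e^{-|x|²/4t} (a|u|²/t + |∇u|²) ≤ c₀ ∫ h^{-2a} e^{-|x|²/4t} |∂ₜu + Δu|²`,
  with the explicit absolute constant `c₀ = 11 e^{4/3}` (the source leaves `c₀` unspecified).

All statements are proved; physical space is any finite-dimensional real inner product space `E`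
(`ℝⁿ` in the source), values in a real inner product space `F` (`ℝᵐ`).

## References

* G. Seregin, *Lecture notes on regularity theory for the Navier–Stokes equations*, World
  Scientific 2014, Appendix A.1, Prop. 1.2, (A.1.1)–(A.1.11), pp. 205–206.
* L. Escauriaza, G. Seregin, V. Šverák, *`L_{3,∞}`-solutions of Navier–Stokes equations and
  backward uniqueness*, Russ. Math. Surveys 58:2 (2003), §6, Prop. 6.1.
* D. Tataru, *Carleman estimates, unique continuation and applications*, notes (2000);
  L. Escauriaza, Duke Math. J. 104 (2000); L. Escauriaza, L. Vega, (2001) — cited by Seregin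
  for the inequality.
-/

noncomputable section

open MeasureTheory Set Function Filter Topology
open scoped InnerProductSpace RealInnerProductSpace

namespace Literature.Analysis.FluidPDE

namespace Carleman

/-! ### The conjugation `v = e^φ u` (Seregin 2014, proof of Prop. 1.2) -/

section Substitution

variable {E : Type*} [NormedAddCommGroup E] [InnerProductSpace ℝ E] [FiniteDimensional ℝ E]
  [MeasurableSpace E] [BorelSpace E]
variable {F : Type*} [NormedAddCommGroup F] [InnerProductSpace ℝ F]

/-! #### Calculus of the weight functions -/

/-- `h'(t) = e^{(1-t)/3} (1 - t/3)`. [folklore] -/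
theorem hasDerivAt_hW (t : ℝ) : HasDerivAt hW (Real.exp ((1 - t) / 3) * (1 - t / 3)) t := by
  have h1 : HasDerivAt (fun s : ℝ => (1 - s) / 3) (-(1 : ℝ) / 3) t := by
    have := ((hasDerivAt_id t).const_sub 1).div_const 3
    exact this.congr_deriv (by ring)
  have h2 : HasDerivAt (fun s : ℝ => Real.exp ((1 - s) / 3)) (Real.exp ((1 - t) / 3) * (-(1 : ℝ) / 3)) t :=
    h1.exp
  have h3 := (hasDerivAt_id t).mul h2
  unfold hW
  refine h3.congr_deriv ?_
  simp only [id]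
  ring

/-- `(log h)'(t) = 1/t - 1/3` for `t > 0`. [folklore] -/
theorem hasDerivAt_log_hW {t : ℝ} (ht : 0 < t) :
    HasDerivAt (fun s => Real.log (hW s)) (1 / t - 1 / 3) t := by
  have h := (Real.hasDerivAt_log (hW_pos ht).ne').comp t (hasDerivAt_hW t)
  refine h.congr_deriv ?_
  have he : Real.exp ((1 - t) / 3) ≠ 0 := (Real.exp_pos _).ne'
  unfold hW
  field_simp

omit [FiniteDimensional ℝ E] [MeasurableSpace E] [BorelSpace E] in
/-- `φ_a` is smooth on `{t > 0}`. [folklore] -/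
theorem contDiffAt_phiW (a : ℝ) {z : ℝ × E} (hz : 0 < z.1) {n : WithTop ℕ∞} :
    ContDiffAt ℝ n (phiW a : ℝ × E → ℝ) z := by
  have h1 : ContDiffAt ℝ n (fun y : ℝ × E => -‖y.2‖ ^ 2 / (8 * y.1)) z :=
    (contDiff_norm_sq_snd.contDiffAt.neg).div (contDiff_const.mul contDiff_fst).contDiffAt
      (mul_ne_zero (by norm_num) hz.ne')
  have h2 : ContDiffAt ℝ n (fun y : ℝ × E => (a + 1) * Real.log (hW y.1)) z := by
    refine contDiffAt_const.mul ?_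
    have hh : ContDiffAt ℝ n (fun y : ℝ × E => hW y.1) z := by
      unfold hW
      exact (contDiff_fst.mul ((contDiff_const.sub contDiff_fst).div_const _).exp).contDiffAt
    exact hh.log (hW_pos hz).ne'
  exact h1.sub h2

omit [FiniteDimensional ℝ E] [MeasurableSpace E] [BorelSpace E] in
/-- **Derivatives of `φ_a`**: `Dφ_a(z)(s, e) = s (|x|²/(8t²) - (a+1)(1/t - 1/3)) - ⟪x, e⟫/(4t)`,
i.e. `∇φ = -x/(4t)`, `∂ₜφ = |x|²/(8t²) - (a+1) h'/h` (Seregin 2014, proof of Prop. 1.2). [cite: Seregin2014, App. A.1, proof of Prop. 1.2] -/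
theorem fderiv_phiW_apply (a : ℝ) {z : ℝ × E} (hz : 0 < z.1) (v : ℝ × E) :
    fderiv ℝ (phiW a : ℝ × E → ℝ) z v =
      v.1 * (‖z.2‖ ^ 2 / (8 * z.1 ^ 2) - (a + 1) * (1 / z.1 - 1 / 3)) - ⟪z.2, v.2⟫ / (4 * z.1) := by
  -- `-|x|²/(8t) = 2ρ`
  have hρ : HasFDerivAt (fun y : ℝ × E => -‖y.2‖ ^ 2 / (16 * y.1))
      (fderiv ℝ (fun y : ℝ × E => -‖y.2‖ ^ 2 / (16 * y.1)) z) z :=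
    ((contDiffAt_rho hz.ne' (n := 1)).differentiableAt one_ne_zero).hasFDerivAt
  have h1 : HasFDerivAt (fun y : ℝ × E => -‖y.2‖ ^ 2 / (8 * y.1))
      ((2 : ℝ) • fderiv ℝ (fun y : ℝ × E => -‖y.2‖ ^ 2 / (16 * y.1)) z) z := by
    have := hρ.const_smul (2 : ℝ)
    refine this.congr_of_eventuallyEq (Eventually.of_forall fun y => ?_)
    show -‖y.2‖ ^ 2 / (8 * y.1) = (2 : ℝ) • (-‖y.2‖ ^ 2 / (16 * y.1))
    rw [smul_eq_mul]
    ring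
  have h2 : HasFDerivAt (fun y : ℝ × E => (a + 1) * Real.log (hW y.1))
      ((a + 1) • (((1 : ℝ →L[ℝ] ℝ).smulRight (1 / z.1 - 1 / 3)).comp
        (ContinuousLinearMap.fst ℝ ℝ E))) z :=
    ((hasDerivAt_log_hW hz).hasFDerivAt.comp z hasFDerivAt_fst).const_mul (a + 1)
  have h : HasFDerivAt (phiW a : ℝ × E → ℝ) _ z := h1.sub h2
  rw [h.fderiv]
  simp only [_root_.sub_apply, _root_.smul_apply, smul_eq_mul, fderiv_rho_apply hz.ne',
    ContinuousLinearMap.comp_apply, ContinuousLinearMap.smulRight_apply, one_apply_eq_self,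
    ContinuousLinearMap.coe_fst']
  field_simp
  ring

/-! #### First and second derivatives of the conjugated field `v = e^φ u` -/

omit [FiniteDimensional ℝ E] [MeasurableSpace E] [BorelSpace E] in
/-- Product rule with an exponential factor: `D(e^φ W)(z) v = e^{φ(z)} (DW(z) v + Dφ(z) v · W(z))`. [folklore] -/
theorem fderiv_exp_smul_apply {φ : ℝ × E → ℝ} {W : ℝ × E → F} {z : ℝ × E}
    (hφ : DifferentiableAt ℝ φ z) (hW : DifferentiableAt ℝ W z) (v : ℝ × E) :
    fderiv ℝ (fun y => Real.exp (φ y) • W y) z v =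
      Real.exp (φ z) • (fderiv ℝ W z v + fderiv ℝ φ z v • W z) := by
  have hψ : HasFDerivAt (fun y => Real.exp (φ y)) (Real.exp (φ z) • fderiv ℝ φ z) z :=
    hφ.hasFDerivAt.exp
  have h : HasFDerivAt (fun y => Real.exp (φ y) • W y) _ z := hψ.smul hW.hasFDerivAt
  rw [h.fderiv]
  simp only [_root_.add_apply, _root_.smul_apply, ContinuousLinearMap.smulRight_apply,
    smul_eq_mul, smul_add, smul_smul]

variable {a δ : ℝ} {U : ℝ × E → F}
variable (hU : ContDiff ℝ (⊤ : ℕ∞) U)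
include hU

omit [FiniteDimensional ℝ E] [MeasurableSpace E] [BorelSpace E] in
/-- `D(e^φ u)(y) v = e^φ (Du(y) v + Dφ(y) v · u(y))` at points with `t > 0`. [cite: Seregin2014, App. A.1 (A.1.11)] -/
theorem fderiv_conj_apply {y : ℝ × E} (hy : 0 < y.1) (v : ℝ × E) :
    fderiv ℝ (fun y : ℝ × E => Real.exp (phiW a y) • U y) y v =
      Real.exp (phiW a y) • (fderiv ℝ U y v + fderiv ℝ (phiW a) y v • U y) :=
  fderiv_exp_smul_apply ((contDiffAt_phiW a hy (n := 1)).differentiableAt one_ne_zero)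
    (hU.differentiable (by simp) y) v

omit [FiniteDimensional ℝ E] [MeasurableSpace E] [BorelSpace E] in
/-- **`∂ₑ(e^φ u) = e^φ (∂ₑu - (xₑ/4t) u)`** at points with `t > 0` (`∇φ = -x/(4t)`). [cite: Seregin2014, App. A.1 (A.1.11)] -/
theorem dx_conj {y : ℝ × E} (hy : 0 < y.1) (e : E) :
    dx e (fun y : ℝ × E => Real.exp (phiW a y) • U y) y =
      Real.exp (phiW a y) • (dx e U y - (⟪y.2, e⟫ / (4 * y.1)) • U y) := by
  rw [dx_apply, fderiv_conj_apply hU hy, fderiv_phiW_apply a hy]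
  simp only [dx_apply, zero_mul, sub_eq_add_neg, zero_add, neg_smul]

omit [FiniteDimensional ℝ E] [MeasurableSpace E] [BorelSpace E] in
/-- **`∂ₜ(e^φ u) = e^φ (∂ₜu + ∂ₜφ u)`**, `∂ₜφ = |x|²/(8t²) - (a+1)(1/t - 1/3)`, at `t > 0`. [cite: Seregin2014, App. A.1, proof of Prop. 1.2] -/
theorem dt_conj {y : ℝ × E} (hy : 0 < y.1) :
    dt (fun y : ℝ × E => Real.exp (phiW a y) • U y) y =
      Real.exp (phiW a y) •
        (dt U y + (‖y.2‖ ^ 2 / (8 * y.1 ^ 2) - (a + 1) * (1 / y.1 - 1 / 3)) • U y) := by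
  rw [dt_apply, fderiv_conj_apply hU hy, fderiv_phiW_apply a hy]
  simp only [dt_apply, one_mul, inner_zero_right, zero_div, sub_zero]

omit [FiniteDimensional ℝ E] [MeasurableSpace E] [BorelSpace E] in
/-- **`(x·∇)(e^φ u) = e^φ ((x·∇)u - (|x|²/4t) u)`** at `t > 0`. [cite: Seregin2014, App. A.1, proof of Prop. 1.2] -/
theorem xdx_conj {y : ℝ × E} (hy : 0 < y.1) :
    xdx (fun y : ℝ × E => Real.exp (phiW a y) • U y) y =
      Real.exp (phiW a y) • (xdx U y - (‖y.2‖ ^ 2 / (4 * y.1)) • U y) := by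
  rw [xdx_apply, fderiv_conj_apply hU hy, fderiv_phiW_apply a hy]
  simp only [xdx_apply, zero_mul, real_inner_self_eq_norm_sq, sub_eq_add_neg, zero_add, neg_smul]

omit [FiniteDimensional ℝ E] [MeasurableSpace E] [BorelSpace E] in
/-- **Second derivatives**: for a unit vector `e` and `t > 0`,
`∂ₑ∂ₑ(e^φ u) = e^φ (∂ₑ∂ₑu - (xₑ/2t) ∂ₑu + (xₑ²/16t² - 1/4t) u)`. [cite: Seregin2014, App. A.1, proof of Prop. 1.2] -/
theorem dx_dx_conj {z : ℝ × E} (hz : 0 < z.1) (e : E) (he : ‖e‖ = 1) :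
    dx e (dx e (fun y : ℝ × E => Real.exp (phiW a y) • U y)) z =
      Real.exp (phiW a z) • (dx e (dx e U) z - (⟪z.2, e⟫ / (2 * z.1)) • dx e U z +
        (⟪z.2, e⟫ ^ 2 / (16 * z.1 ^ 2) - 1 / (4 * z.1)) • U z) := by
  -- near `z`, `∂ₑ v = e^φ K` with `K = ∂ₑu - q u`, `q = xₑ/(4t)`
  set q : ℝ × E → ℝ := fun y => ⟪y.2, e⟫ / (4 * y.1) with hq
  set K : ℝ × E → F := fun y => dx e U y - q y • U y with hK
  have hev : dx e (fun y : ℝ × E => Real.exp (phiW a y) • U y) =ᶠ[𝓝 z]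
      fun y => Real.exp (phiW a y) • K y := by
    filter_upwards [(isOpen_lt continuous_const continuous_fst).mem_nhds hz] with y hy
    exact dx_conj hU hy e
  rw [dx_apply, hev.fderiv_eq]
  -- differentiability at `z`
  have hUd : DifferentiableAt ℝ U z := hU.differentiable (by simp) z
  have hdxU : DifferentiableAt ℝ (dx e U) z := (contDiff_dx hU e).differentiable (by simp) z
  have hq1 : HasFDerivAt (fun y : ℝ × E => ⟪y.2, e⟫) ((innerSL ℝ e).comp (ContinuousLinearMap.snd ℝ ℝ E)) z := by
    have h1 : (fun y : ℝ × E => ⟪y.2, e⟫) =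
        fun y => ((innerSL ℝ e).comp (ContinuousLinearMap.snd ℝ ℝ E)) y := by
      funext y; simp [real_inner_comm]
    rw [h1]
    exact ContinuousLinearMap.hasFDerivAt _
  have hk : HasDerivAt (fun t : ℝ => (4 * t)⁻¹) (-(4 * 1) / (4 * id z.1) ^ 2) z.1 :=
    ((hasDerivAt_id z.1).const_mul 4).inv (mul_ne_zero (by norm_num) hz.ne')
  have hq2 : HasFDerivAt (fun y : ℝ × E => (4 * y.1)⁻¹)
      (((1 : ℝ →L[ℝ] ℝ).smulRight (-(4 * 1) / (4 * id z.1) ^ 2)).comp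
        (ContinuousLinearMap.fst ℝ ℝ E)) z :=
    hk.hasFDerivAt.comp z hasFDerivAt_fst
  have hqd : HasFDerivAt q _ z := hq1.mul hq2
  have hqv : fderiv ℝ q z (0, e) = 1 / (4 * z.1) := by
    rw [hqd.fderiv]
    simp only [_root_.add_apply, _root_.smul_apply, smul_eq_mul, ContinuousLinearMap.comp_apply,
      ContinuousLinearMap.smulRight_apply, one_apply_eq_self, ContinuousLinearMap.coe_fst',
      ContinuousLinearMap.coe_snd', innerSL_apply_apply, real_inner_self_eq_norm_sq, he, id]
    ring
  have hKd : HasFDerivAt K (fderiv ℝ (dx e U) z - (q z • fderiv ℝ U z + (fderiv ℝ q z).smulRight (U z))) z :=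
    hdxU.hasFDerivAt.sub (hqd.differentiableAt.hasFDerivAt.smul hUd.hasFDerivAt)
  have hKv : fderiv ℝ K z (0, e) = dx e (dx e U) z - (q z • dx e U z + (1 / (4 * z.1)) • U z) := by
    rw [hKd.fderiv]
    simp only [_root_.sub_apply, _root_.add_apply, _root_.smul_apply,
      ContinuousLinearMap.smulRight_apply, hqv, dx_apply]
  rw [fderiv_exp_smul_apply ((contDiffAt_phiW a hz (n := 1)).differentiableAt one_ne_zero)
    hKd.differentiableAt, hKv, fderiv_phiW_apply a hz]
  simp only [hK, hq, zero_mul, zero_sub, dx_apply]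
  match_scalars <;> field_simp <;> ring

omit [MeasurableSpace E] [BorelSpace E] in
/-- **The conjugated Laplacian**: at `t > 0`,
`Δ(e^φ u) = e^φ (Δu - (1/2t)(x·∇)u + (|x|²/16t² - n/4t) u)`
(`Δv = e^φ (Δu + 2∇φ·∇u + (|∇φ|² + Δφ) u)` with `∇φ = -x/(4t)`, `Δφ = -n/(4t)`). [cite: Seregin2014, App. A.1, proof of Prop. 1.2] -/
theorem lap_conj {z : ℝ × E} (hz : 0 < z.1) :
    lap (fun y : ℝ × E => Real.exp (phiW a y) • U y) z =
      Real.exp (phiW a z) • (lap U z - (1 / (2 * z.1)) • xdx U z +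
        (‖z.2‖ ^ 2 / (16 * z.1 ^ 2) - Module.finrank ℝ E / (4 * z.1)) • U z) := by
  set b := stdOrthonormalBasis ℝ E with hb
  have step : ∀ i, dx (b i) (dx (b i) (fun y : ℝ × E => Real.exp (phiW a y) • U y)) z =
      Real.exp (phiW a z) • (dx (b i) (dx (b i) U) z - (⟪z.2, b i⟫ / (2 * z.1)) • dx (b i) U z +
        (⟪z.2, b i⟫ ^ 2 / (16 * z.1 ^ 2) - 1 / (4 * z.1)) • U z) :=
    fun i => dx_dx_conj hU hz (b i) (b.norm_eq_one i)
  rw [lap, Finset.sum_congr rfl fun i _ => step i, ← Finset.smul_sum]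
  congr 1
  simp only [Finset.sum_add_distrib, Finset.sum_sub_distrib]
  -- `Σᵢ ∂ᵢ∂ᵢu = Δu`, `Σᵢ (xᵢ/2t) ∂ᵢu = (1/2t)(x·∇)u`, `Σᵢ (xᵢ²/16t² - 1/4t) = |x|²/16t² - n/4t`
  have e1 : ∑ i, dx (b i) (dx (b i) U) z = lap U z := rfl
  have e2 : ∑ i, (⟪z.2, b i⟫ / (2 * z.1)) • dx (b i) U z = (1 / (2 * z.1)) • xdx U z := by
    rw [xdx_eq_sum, Finset.smul_sum]
    refine Finset.sum_congr rfl fun i _ => ?_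
    rw [smul_smul]
    congr 1
    ring
  have e3 : ∑ i, (⟪z.2, b i⟫ ^ 2 / (16 * z.1 ^ 2) - 1 / (4 * z.1)) • U z =
      (‖z.2‖ ^ 2 / (16 * z.1 ^ 2) - Module.finrank ℝ E / (4 * z.1)) • U z := by
    rw [← Finset.sum_smul]
    congr 1
    rw [Finset.sum_sub_distrib, ← Finset.sum_div, b.sum_sq_inner_left, Finset.sum_const,
      Finset.card_univ, Fintype.card_fin, nsmul_eq_mul]
    ring
  rw [e1, e2, e3]

omit [MeasurableSpace E] [BorelSpace E] in
/-- **The conjugated operator** (Seregin 2014, (A.1.2): `tL v = S v + A v` for `v = e^φ u`,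
`L v := e^φ (∂ₜu + Δu)`): for `u` smooth and supported in `{t ≥ δ}`, `δ > 0`, and every `z`,
`P (e^φ u)(z) = t e^{φ(z)} (∂ₜu + Δₓu)(z)` — all zeroth- and first-order terms produced by the
conjugation cancel against `r_a v`, `½(x·∇)v` and `(½ + n/4) v`. [cite: Seregin2014, App. A.1 (A.1.2)] -/
theorem opP_conj (hδ : 0 < δ) (hUδ : tsupport U ⊆ {z | δ ≤ z.1}) (z : ℝ × E) :
    opP a (fun y : ℝ × E => Real.exp (phiW a y) • U y) z =
      (z.1 * Real.exp (phiW a z)) • (dt U z + lap U z) := by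
  by_cases hz : δ / 2 < z.1
  · have ht : 0 < z.1 := lt_trans (by positivity) hz
    have ht' : z.1 ≠ 0 := ht.ne'
    simp only [opP, opS, opA, lap_conj hU ht, dt_conj hU ht, xdx_conj hU ht, rW, gS]
    match_scalars <;> field_simp <;> ring
  · -- both sides vanish off the support
    have hzδ : z.1 < δ := by linarith [not_lt.1 hz]
    have hVs : tsupport (fun y : ℝ × E => Real.exp (phiW a y) • U y) ⊆ tsupport U :=
      (tsupport_smul_subset_right _ _)
    have hz' : z ∉ tsupport (fun y : ℝ × E => Real.exp (phiW a y) • U y) := fun h =>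
      (not_le.2 hzδ) (hUδ (hVs h))
    rw [opP_eq_zero_of_notMem_tsupport hz']
    have h1 : fderiv ℝ U z = 0 := fderiv_eq_zero_of_lt hUδ hzδ
    have h2 : lap U z = 0 := eq_zero_of_lt ((tsupport_lap_subset U).trans hUδ) hzδ
    simp [dt, h1, h2]

omit [MeasurableSpace E] [BorelSpace E] in
/-- **The gradient bound** `e^{2φ} |∇u|² ≤ 2 |∇v|² + (|x|²/8t²) |v|²` at `t > 0`
(from `e^φ ∂ᵢu = ∂ᵢv + (xᵢ/4t) v`, (A.1.11)). [cite: Seregin2014, App. A.1 (A.1.11)] -/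
theorem exp_mul_gradSq_le {z : ℝ × E} (hz : 0 < z.1) :
    Real.exp (2 * phiW a z) * gradSq U z ≤
      2 * gradSq (fun y : ℝ × E => Real.exp (phiW a y) • U y) z +
        ‖z.2‖ ^ 2 / (8 * z.1 ^ 2) * ‖Real.exp (phiW a z) • U z‖ ^ 2 := by
  set b := stdOrthonormalBasis ℝ E with hb
  set V : ℝ × E → F := fun y => Real.exp (phiW a y) • U y with hV
  set ψ : ℝ := Real.exp (phiW a z) with hψ
  have hψ0 : 0 < ψ := Real.exp_pos _
  -- per coordinate: `ψ ∂ᵢu = ∂ᵢv + (xᵢ/4t) v`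
  have step : ∀ i, ψ • dx (b i) U z = dx (b i) V z + (⟪z.2, b i⟫ / (4 * z.1)) • V z := by
    intro i
    rw [hV, dx_conj hU hz (b i), smul_sub, smul_smul, smul_smul, mul_comm]
    abel
  have hpt : ∀ i, ψ ^ 2 * ‖dx (b i) U z‖ ^ 2 ≤
      2 * ‖dx (b i) V z‖ ^ 2 + 2 * ((⟪z.2, b i⟫ / (4 * z.1)) ^ 2 * ‖V z‖ ^ 2) := by
    intro i
    have e : ψ ^ 2 * ‖dx (b i) U z‖ ^ 2 = ‖dx (b i) V z + (⟪z.2, b i⟫ / (4 * z.1)) • V z‖ ^ 2 := by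
      rw [← step i, norm_smul, Real.norm_of_nonneg hψ0.le, mul_pow]
    rw [e]
    have h := norm_add_le (dx (b i) V z) ((⟪z.2, b i⟫ / (4 * z.1)) • V z)
    rw [norm_smul, Real.norm_eq_abs] at h
    nlinarith [sq_nonneg (‖dx (b i) V z‖ - |⟪z.2, b i⟫ / (4 * z.1)| * ‖V z‖), norm_nonneg (dx (b i) V z + (⟪z.2, b i⟫ / (4 * z.1)) • V z), sq_abs (⟪z.2, b i⟫ / (4 * z.1)), norm_nonneg (dx (b i) V z), abs_nonneg (⟪z.2, b i⟫ / (4 * z.1)), norm_nonneg (V z)]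
  -- sum over the frame
  have hexp2 : Real.exp (2 * phiW a z) = ψ ^ 2 := by
    rw [hψ, ← Real.exp_nat_mul]; norm_num
  calc Real.exp (2 * phiW a z) * gradSq U z
      = ∑ i, ψ ^ 2 * ‖dx (b i) U z‖ ^ 2 := by rw [hexp2, gradSq, Finset.mul_sum]
    _ ≤ ∑ i, (2 * ‖dx (b i) V z‖ ^ 2 + 2 * ((⟪z.2, b i⟫ / (4 * z.1)) ^ 2 * ‖V z‖ ^ 2)) :=
        Finset.sum_le_sum fun i _ => hpt i
    _ = 2 * gradSq V z + ‖z.2‖ ^ 2 / (8 * z.1 ^ 2) * ‖V z‖ ^ 2 := by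
        rw [Finset.sum_add_distrib, ← Finset.mul_sum, ← Finset.mul_sum, ← Finset.sum_mul, gradSq]
        have hs : ∑ i, (⟪z.2, b i⟫ / (4 * z.1)) ^ 2 = ‖z.2‖ ^ 2 / (16 * z.1 ^ 2) := by
          simp_rw [div_pow]
          rw [← Finset.sum_div, b.sum_sq_inner_left]
          ring
        rw [hs]
        ring

/-! #### The first Carleman inequality (Seregin 2014, Prop. 1.2) -/

omit [InnerProductSpace ℝ E] [FiniteDimensional ℝ E] [MeasurableSpace E] [BorelSpace E]
  [NormedAddCommGroup F] [InnerProductSpace ℝ F] hU in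
/-- Continuity on `{t > δ/2}` (`δ > 0`) of the Carleman weight. [folklore] -/
theorem continuousOn_carlemanWeight (a : ℝ) {δ : ℝ} (hδ : 0 < δ) :
    ContinuousOn (carlemanWeight a : ℝ × E → ℝ) {z | δ / 2 < z.1} := by
  have ht : ∀ z : ℝ × E, δ / 2 < z.1 → 0 < z.1 := fun z hz => lt_trans (by positivity) hz
  refine ContinuousOn.mul ?_ ?_
  · refine ContinuousOn.rpow_const ?_ fun z hz => Or.inl (hW_pos (ht z hz)).ne'
    unfold hW
    exact (continuous_fst.mul ((continuous_const.sub continuous_fst).div_const _).rexp).continuousOn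
  · refine (ContinuousOn.div ?_ ?_ fun z hz => mul_ne_zero (by norm_num) (ht z hz).ne').rexp
    · exact (continuous_snd.norm.pow 2).neg.continuousOn
    · exact (continuous_const.mul continuous_fst).continuousOn

omit [InnerProductSpace ℝ E] [FiniteDimensional ℝ E] [MeasurableSpace E] [BorelSpace E]
  [NormedAddCommGroup F] [InnerProductSpace ℝ F] hU in
/-- `e^{2φ} = (e^φ)²`. [folklore] -/
theorem exp_two_mul_phiW (a : ℝ) (z : ℝ × E) :
    Real.exp (2 * phiW a z) = Real.exp (phiW a z) ^ 2 := by
  rw [← Real.exp_nat_mul]; norm_num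

/-- **The first Carleman inequality** (Seregin 2014, App. A, Prop. 1.2, (A.1.1); Escauriaza–
Seregin–Šverák 2003, §6; cf. Escauriaza 2000, Escauriaza–Vega 2001, Tataru 2000): for every
smooth `u : ℝⁿ × ]0, 2[ → ℝᵐ` with compact support (here: `u : ℝ × E → F` smooth, compactly
supported, with support in the open slab `]0, 2[ × E`; `E`, `F` finite-dimensional real inner
product spaces) and every `a > 0`,
`∫ h^{-2a}(t) e^{-|x|²/4t} (a |u|²/t + |∇u|²) dx dt ≤ c₀ ∫ h^{-2a}(t) e^{-|x|²/4t} |∂ₜu + Δu|² dx dt`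
with `h(t) = t e^{(1-t)/3}` and an absolute constant `c₀` (here `c₀ = 11 e^{4/3} < 42`; the source
does not specify it). Proof (Seregin 2014, pp. 205–206 = the `L₂` method of Hörmander–Tataru):
with `v = e^φ u`, `φ = -|x|²/8t - (a+1) log h`, one has `t e^φ(∂ₜu + Δu) = P v` (`opP_conj`),
`(a+1) ∫ t|v|² ≤ 3 ∫|Pv|²` and `∫ t²|∇v|² + ∫ |x|²|v|²/16 ≤ 4 ∫|Pv|²`
(`FluidPDE/CarlemanFirst`), `e^{2φ}|∇u|² ≤ 2|∇v|² + |x|²|v|²/8t²` ((A.1.11)), and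
`t² e^{2φ} = e^{-2(1-t)/3} h^{-2a} e^{-|x|²/4t}` with `e^{-2/3} ≤ e^{-2(1-t)/3} ≤ e^{2/3}` on
`0 < t ≤ 2`. The integrals are over all of `ℝ × E`: both integrands vanish identically off the
support of `u` (where `u`, `∇u`, `∂ₜu`, `Δu` vanish), so this is the printed integral over
`ℝⁿ × ]0, 2[` and the junk values of the weight for `t ≤ 0` never enter. [cite: Seregin2014, App. A.1 Prop. 1.2 (A.1.1)] -/
theorem carleman_inequality_first (hUc : HasCompactSupport U)
    (hUs : tsupport U ⊆ Ioo (0 : ℝ) 2 ×ˢ (univ : Set E)) (ha : 0 < a) :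
    ∫ z, carlemanWeight a z * (a / z.1 * ‖U z‖ ^ 2 + gradSq U z) ≤
      11 * Real.exp (4 / 3) * ∫ z, carlemanWeight a z * ‖dt U z + lap U z‖ ^ 2 := by
  set b := stdOrthonormalBasis ℝ E with hb
  -- ## degenerate case: `u = 0`
  by_cases hne : (tsupport U).Nonempty
  swap
  · have hU0 : ∀ z, U z = 0 := fun z =>
      image_eq_zero_of_notMem_tsupport fun h => hne ⟨z, h⟩
    have hdU0 : ∀ z, fderiv ℝ U z = 0 := fun z =>
      fderiv_of_notMem_tsupport (𝕜 := ℝ) fun h => hne ⟨z, h⟩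
    have hlap0 : ∀ z, lap U z = 0 := fun z =>
      image_eq_zero_of_notMem_tsupport fun h => hne ⟨z, tsupport_lap_subset U h⟩
    have hg0 : ∀ z, gradSq U z = 0 := fun z => by simp [gradSq, dx, hdU0 z]
    simp [hU0, hg0, hlap0, dt, hdU0]
  -- ## the support lies in `{δ ≤ t ≤ 2}` for some `δ > 0`
  obtain ⟨z₀, hz₀, hmin⟩ := hUc.isCompact.exists_isMinOn hne continuous_fst.continuousOn
  set δ : ℝ := z₀.1 with hδdef
  have hδ : 0 < δ := (hUs hz₀).1.1
  have hUδ : tsupport U ⊆ {z | δ ≤ z.1} := fun z hz => hmin hz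
  have hU2 : tsupport U ⊆ {z | z.1 ≤ 2} := fun z hz => (hUs hz).1.2.le
  have hUpos : ∀ z ∈ tsupport U, 0 < z.1 := fun z hz => (hUs hz).1.1
  -- ## the conjugated field `v = e^φ u`
  set V : ℝ × E → F := fun y => Real.exp (phiW a y) • U y with hVdef
  have hVs : tsupport V ⊆ tsupport U := tsupport_smul_subset_right _ _
  have hVδ : tsupport V ⊆ {z | δ ≤ z.1} := hVs.trans hUδ
  have hV2 : tsupport V ⊆ {z | z.1 ≤ 2} := hVs.trans hU2
  have hVc : HasCompactSupport V := hUc.smul_left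
  have hV : ContDiff ℝ (⊤ : ℕ∞) V := by
    refine contDiff_of_zero_of_lt hδ (fun y hy => ?_) fun y hy => ?_
    · have ht : 0 < y.1 := lt_trans (by positivity) hy
      exact ((contDiffAt_phiW a ht).exp.smul hU.contDiffAt).contDiffWithinAt
    · simp [hVdef, eq_zero_of_lt hUδ hy]
  -- ## the `L₂` estimates for `v`
  have hR1 := integral_mul_norm_sq_le_three_mul hδ hV hVc hVδ (a := a)
  have hR2 := integral_gradSq_add_le_four_mul hδ hV hVc hVδ (a := a) (by linarith) hV2
  -- ## `∫ |P v|² = ∫ t² e^{2φ} |∂ₜu + Δu|² ≤ e^{2/3} ∫ w |∂ₜu + Δu|²`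
  set X : ℝ × E → F := fun z => dt U z + lap U z with hX
  have hX0 : ∀ z, z ∉ tsupport U → X z = 0 := fun z hz => by
    have h1 : fderiv ℝ U z = 0 := fderiv_of_notMem_tsupport (𝕜 := ℝ) hz
    have h2 : lap U z = 0 := image_eq_zero_of_notMem_tsupport fun h => hz (tsupport_lap_subset U h)
    simp [hX, dt, h1, h2]
  have hPz : ∀ z, ‖opP a V z‖ ^ 2 = z.1 ^ 2 * Real.exp (2 * phiW a z) * ‖X z‖ ^ 2 := fun z => by
    rw [hVdef, opP_conj hU hδ hUδ z, norm_smul, mul_pow, Real.norm_eq_abs, exp_two_mul_phiW,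
      abs_mul, abs_of_pos (Real.exp_pos _), mul_pow, sq_abs]
  have hw2 : ∀ z ∈ tsupport U, z.1 ^ 2 * Real.exp (2 * phiW a z) ≤
      Real.exp (2 / 3) * carlemanWeight a z := by
    intro z hz
    have ht := hUpos z hz
    rw [sq_mul_exp_two_mul_phiW a ht]
    refine mul_le_mul_of_nonneg_right (Real.exp_le_exp.2 ?_) (carlemanWeight_pos a ht).le
    have := hU2 hz
    simp only [Set.mem_setOf_eq] at this
    linarith
  have hw1 : ∀ z ∈ tsupport U, carlemanWeight a z ≤
      Real.exp (2 / 3) * (z.1 ^ 2 * Real.exp (2 * phiW a z)) := by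
    intro z hz
    have ht := hUpos z hz
    rw [sq_mul_exp_two_mul_phiW a ht, ← mul_assoc, ← Real.exp_add]
    have h1 : (1 : ℝ) ≤ Real.exp (2 / 3 + -(2 * (1 - z.1) / 3)) := Real.one_le_exp (by linarith)
    nlinarith [carlemanWeight_pos a ht]
  -- continuity of the weight on `{t > δ/2}` and integrabilities
  set W := (carlemanWeight a : ℝ × E → ℝ) with hWdef
  have cw : ContinuousOn W {z | δ / 2 < z.1} := continuousOn_carlemanWeight a hδ
  have cX : Continuous X := (contDiff_dt hU).continuous.add (contDiff_lap hU).continuous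
  have hXs : tsupport X ⊆ {z | δ ≤ z.1} := by
    refine (closure_minimal (fun z hz => ?_) (isClosed_tsupport U)).trans hUδ
    by_contra h
    exact hz (hX0 z h)
  have hXc : HasCompactSupport X := hUc.mono' fun z hz => by
    by_contra h
    exact hz (hX0 z h)
  have iWX : Integrable fun z => W z * ‖X z‖ ^ 2 :=
    integrable_of_continuous_hasCompactSupport (continuous_mul_norm_sq_of_support hδ cw cX hXs)
      (hasCompactSupport_mul_norm_sq hXc)
  have iP := integrable_norm_sq_opP hδ hV hVc hVδ (a := a)
  have hPle : ∫ z, ‖opP a V z‖ ^ 2 ≤ Real.exp (2 / 3) * ∫ z, W z * ‖X z‖ ^ 2 := by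
    rw [← integral_const_mul]
    refine integral_mono iP (iWX.const_mul _) fun z => ?_
    show ‖opP a V z‖ ^ 2 ≤ Real.exp (2 / 3) * (W z * ‖X z‖ ^ 2)
    rw [hPz z]
    by_cases hz : z ∈ tsupport U
    · have := hw2 z hz
      nlinarith [sq_nonneg ‖X z‖]
    · simp [hX0 z hz]
  -- ## the zeroth-order term: `∫ w (a/t)|u|² ≤ e^{2/3} (a+1) ∫ t|v|²`
  have ct : ContinuousOn (fun z : ℝ × E => W z * (a / z.1)) {z | δ / 2 < z.1} :=
    cw.mul (continuousOn_const.div continuousOn_fst fun z hz =>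
      (lt_trans (by positivity) (show δ / 2 < z.1 from hz)).ne')
  have i0 : Integrable fun z => W z * (a / z.1) * ‖U z‖ ^ 2 :=
    integrable_of_continuous_hasCompactSupport (continuous_mul_norm_sq_of_support hδ ct
      hU.continuous hUδ) (hasCompactSupport_mul_norm_sq hUc)
  have itV := integrable_mul_norm_sq hδ hV hVc hVδ (w := fun z : ℝ × E => z.1)
    continuous_fst.continuousOn
  have h0le : ∫ z, W z * (a / z.1) * ‖U z‖ ^ 2 ≤
      Real.exp (2 / 3) * (a + 1) * ∫ z, z.1 * ‖V z‖ ^ 2 := by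
    rw [← integral_const_mul]
    refine integral_mono i0 (itV.const_mul _) fun z => ?_
    show W z * (a / z.1) * ‖U z‖ ^ 2 ≤ Real.exp (2 / 3) * (a + 1) * (z.1 * ‖V z‖ ^ 2)
    by_cases hz : z ∈ tsupport U
    · have ht := hUpos z hz
      have hVn : ‖V z‖ ^ 2 = Real.exp (2 * phiW a z) * ‖U z‖ ^ 2 := by
        rw [hVdef, norm_smul, mul_pow, Real.norm_eq_abs, abs_of_pos (Real.exp_pos _),
          exp_two_mul_phiW]
      rw [hVn]
      have h1 := hw1 z hz
      have hw0 := (carlemanWeight_pos a ht).le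
      -- `W (a/t) |u|² ≤ e^{2/3} (t² e^{2φ}) (a/t) |u|² = e^{2/3} a t e^{2φ}|u|² ≤ e^{2/3}(a+1) t e^{2φ}|u|²`
      have h2 : W z * (a / z.1) * ‖U z‖ ^ 2 ≤
          Real.exp (2 / 3) * (z.1 ^ 2 * Real.exp (2 * phiW a z)) * (a / z.1) * ‖U z‖ ^ 2 := by
        have : 0 ≤ a / z.1 * ‖U z‖ ^ 2 := by positivity
        nlinarith
      have h3 : Real.exp (2 / 3) * (z.1 ^ 2 * Real.exp (2 * phiW a z)) * (a / z.1) * ‖U z‖ ^ 2 =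
          Real.exp (2 / 3) * a * (z.1 * (Real.exp (2 * phiW a z) * ‖U z‖ ^ 2)) := by
        field_simp
      have h4 : Real.exp (2 / 3) * a * (z.1 * (Real.exp (2 * phiW a z) * ‖U z‖ ^ 2)) ≤
          Real.exp (2 / 3) * (a + 1) * (z.1 * (Real.exp (2 * phiW a z) * ‖U z‖ ^ 2)) := by
        have : 0 ≤ z.1 * (Real.exp (2 * phiW a z) * ‖U z‖ ^ 2) := by positivity
        nlinarith [Real.exp_pos (2 / 3 : ℝ)]
      linarith
    · have : U z = 0 := image_eq_zero_of_notMem_tsupport hz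
      have : V z = 0 := image_eq_zero_of_notMem_tsupport fun h => hz (hVs h)
      simp [*]
  -- ## the gradient term: `∫ w |∇u|² ≤ 2 e^{2/3} (∫ t²|∇v|² + ∫ |x|²|v|²/16)`
  have hgradSq0 : ∀ z, z ∉ tsupport U → gradSq U z = 0 := fun z hz => by
    simp [gradSq, dx, fderiv_of_notMem_tsupport (𝕜 := ℝ) hz]
  have cg : Continuous (gradSq U) := by
    unfold gradSq
    exact continuous_finsetSum _ fun i _ => ((contDiff_dx hU _).continuous.norm.pow 2)
  have ig : Integrable fun z => W z * gradSq U z := by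
    refine integrable_of_continuous_hasCompactSupport ?_ ?_
    · refine continuous_of_zero_of_lt hδ (cw.mul cg.continuousOn) fun z hz => ?_
      simp [hgradSq0 z fun h => (not_le.2 hz) (hUδ h)]
    · exact hUc.mono' fun z hz => by
        by_contra h
        exact hz (by simp [hgradSq0 z h])
  have itg := integrable_mul_gradSq hV hVc (g := fun t => t ^ 2) (continuous_id.pow 2)
  have ixV := integrable_mul_norm_sq hδ hV hVc hVδ (w := fun z : ℝ × E => ‖z.2‖ ^ 2 / 16)
    ((continuous_snd.norm.pow 2).div_const _).continuousOn
  have hgle : ∫ z, W z * gradSq U z ≤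
      2 * Real.exp (2 / 3) * ((∫ z, z.1 ^ 2 * gradSq V z) + ∫ z, ‖z.2‖ ^ 2 / 16 * ‖V z‖ ^ 2) := by
    rw [← integral_add itg ixV, ← integral_const_mul]
    refine integral_mono ig ((itg.add ixV).const_mul _) fun z => ?_
    show W z * gradSq U z ≤
      2 * Real.exp (2 / 3) * (z.1 ^ 2 * gradSq V z + ‖z.2‖ ^ 2 / 16 * ‖V z‖ ^ 2)
    by_cases hz : z ∈ tsupport U
    · have ht := hUpos z hz
      have h1 := hw1 z hz
      have hb := exp_mul_gradSq_le hU (a := a) ht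
      have hg0 : 0 ≤ gradSq U z := gradSq_nonneg U z
      have hgV0 : 0 ≤ gradSq V z := gradSq_nonneg V z
      -- `W |∇u|² ≤ e^{2/3} t² e^{2φ}|∇u|² ≤ e^{2/3} t² (2|∇v|² + |x|²|v|²/8t²)`
      have h2 : W z * gradSq U z ≤ Real.exp (2 / 3) * (z.1 ^ 2 * Real.exp (2 * phiW a z)) * gradSq U z :=
        mul_le_mul_of_nonneg_right h1 hg0
      have h3 : z.1 ^ 2 * Real.exp (2 * phiW a z) * gradSq U z ≤
          z.1 ^ 2 * (2 * gradSq V z + ‖z.2‖ ^ 2 / (8 * z.1 ^ 2) * ‖V z‖ ^ 2) := by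
        rw [mul_assoc]
        exact mul_le_mul_of_nonneg_left hb (sq_nonneg _)
      have h4 : z.1 ^ 2 * (2 * gradSq V z + ‖z.2‖ ^ 2 / (8 * z.1 ^ 2) * ‖V z‖ ^ 2) =
          2 * (z.1 ^ 2 * gradSq V z + ‖z.2‖ ^ 2 / 16 * ‖V z‖ ^ 2) := by
        field_simp
        ring
      nlinarith [Real.exp_pos (2 / 3 : ℝ)]
    · have hVz : V z = 0 := image_eq_zero_of_notMem_tsupport fun h => hz (hVs h)
      have hgV : gradSq V z = 0 := by
        simp [gradSq, dx, fderiv_of_notMem_tsupport (𝕜 := ℝ) (fun h => hz (hVs h))]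
      simp [hgradSq0 z hz, hVz, hgV]
  -- ## assembly
  have hsplit : ∫ z, W z * (a / z.1 * ‖U z‖ ^ 2 + gradSq U z) =
      (∫ z, W z * (a / z.1) * ‖U z‖ ^ 2) + ∫ z, W z * gradSq U z := by
    rw [← integral_add i0 ig]
    refine integral_congr_ae (Eventually.of_forall fun z => ?_)
    show W z * (a / z.1 * ‖U z‖ ^ 2 + gradSq U z) = W z * (a / z.1) * ‖U z‖ ^ 2 + W z * gradSq U z
    ring
  have hexp : Real.exp (2 / 3) * Real.exp (2 / 3) = Real.exp (4 / 3) := by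
    rw [← Real.exp_add]; norm_num
  have hRpos : 0 ≤ ∫ z, W z * ‖X z‖ ^ 2 := by
    refine integral_nonneg fun z => ?_
    by_cases hz : z ∈ tsupport U
    · exact mul_nonneg (carlemanWeight_pos a (hUpos z hz)).le (sq_nonneg _)
    · simp [hX0 z hz]
  rw [hsplit]
  have e23 : 0 < Real.exp (2 / 3) := Real.exp_pos _
  nlinarith [hR1, hR2, hPle, h0le, hgle, hRpos, hexp, e23]

end Substitution

end Carleman

end Literature.Analysis.FluidPDE
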